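import Summits.QuantumAdvantage.QuantumAdvantage.Theses.LinnikCubicClassGroups
import Literature.Computability.Cryptography.CubicClassTableSpecs
import Literature.NumberTheory.CubicFields.PureCubicLatticeSemantics
import Literature.NumberTheory.NumberFields.PureCubicOrder
import Literature.NumberTheory.CubicFields.VoronoiCylinderStep

/-!
# Crux `LinnikCubicClassGroups.PureCubicClassGroupFBQP` (stmt-QuantumAdvantage-11544) — stub `stub_classTableSem`, part SLOTS

Line `arakelov-giant-step-cycle`, stub `stub_classTableSem` (S5b-P5b), SECOND PART: the GENERATOR SLOTS of the coin-free class
table. With the true cube roots `r³ ≡ ab² (mod p)` in place of the coin-driven root program, the `T = 3|ps|` generator codes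
`gT · t` are the canonical codes of nonzero integral ideals `𝔤_t`: the degree-one primes above the primes of `ps` (each prime of
norm `p ∈ ps` occurs) and copies of `𝓞_K`; and they do not depend on the position.

* `cubeRoots_length_le_three` — `X³ − ab²` has at most three roots modulo a prime (`Polynomial.card_roots'`);
* `gens_trueRoots_spec`, `slots_package` — the slots and their ideals (`PrimeSem`: Dedekind–Kummer on codes).
-/

set_option linter.dupNamespace false

namespace Summit.QuantumAdvantage.QuantumAdvantage.Theorems.LinnikCubicClassGroups

open scoped NumberField nonZeroDivisors
open NumberField Polynomial
open Literature.NumberTheory.CubicFields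
open Literature.NumberTheory.CubicFields.PureCubicCodes (Canon Mem)
open Literature.Computability.Cryptography
open Literature.Computability.Cryptography.CubicClassTable

/-- **At most three cube roots modulo a prime**: the list of `r < p` with `r³ ≡ c (mod p)` has length `≤ 3`. -/
theorem cubeRoots_length_le_three {p : ℕ} (hp : p.Prime) (c : ℕ) :
    ((List.range p).filter (fun r => r ^ 3 % p = c % p)).length ≤ 3 := by
  classical
  haveI : Fact p.Prime := ⟨hp⟩
  set l := (List.range p).filter (fun r => r ^ 3 % p = c % p) with hl
  have hnd : l.Nodup := List.Nodup.filter _ List.nodup_range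
  set f : ℕ → ZMod p := fun r => (r : ZMod p) with hf
  set P : Polynomial (ZMod p) := X ^ 3 - C (c : ZMod p) with hP
  have hP0 : P ≠ 0 := X_pow_sub_C_ne_zero (by norm_num) _
  have hsub : l.toFinset.image f ⊆ P.roots.toFinset := by
    intro x hx
    rw [Finset.mem_image] at hx
    obtain ⟨r, hr, rfl⟩ := hx
    rw [List.mem_toFinset, hl, List.mem_filter, List.mem_range, decide_eq_true_eq] at hr
    rw [Multiset.mem_toFinset, mem_roots hP0, IsRoot, hP, eval_sub, eval_pow, eval_X, eval_C, sub_eq_zero]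
    have h : ((r ^ 3 : ℕ) : ZMod p) = (c : ZMod p) := (ZMod.natCast_eq_natCast_iff' _ _ _).2 hr.2
    push_cast at h; exact h
  have hinj : Set.InjOn f (l.toFinset : Set ℕ) := by
    intro r hr r' hr' h
    rw [Finset.mem_coe, List.mem_toFinset, hl, List.mem_filter, List.mem_range] at hr hr'
    have h1 : (r : ZMod p).val = r := ZMod.val_cast_of_lt hr.1
    have h2 : (r' : ZMod p).val = r' := ZMod.val_cast_of_lt hr'.1
    have h3 := congrArg ZMod.val h
    rw [h1, h2] at h3; exact h3
  calc l.length = l.toFinset.card := (List.toFinset_card_of_nodup hnd).symm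
    _ = (l.toFinset.image f).card := (Finset.card_image_of_injOn hinj).symm
    _ ≤ P.roots.toFinset.card := Finset.card_le_card hsub
    _ ≤ Multiset.card P.roots := Multiset.toFinset_card_le _
    _ ≤ P.natDegree := card_roots' P
    _ = 3 := by rw [hP, natDegree_X_pow_sub_C]

section Slots

variable {K : Type} [Field K] [NumberField K] {a b : ℕ} {θ : K}
variable {F : WalkFns} {I : Inst} (ha : I.a = a) (hb : I.b = b) (hm : I.m = a * b ^ 2)
  (hps : ∀ p ∈ I.ps, p.Prime ∧ ¬ p ∣ 3 * I.m)
  (hord : Canon I.ord) (hordm : ∀ φ : K, Mem θ b I.ord φ ↔ IsIntegral ℤ φ)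
  (hprime : PrimeSem F a b K θ I.ord)
  (hroots : ∀ x, F.roots x = (List.range x.1).filter (fun r => r ^ 3 % x.1 = x.2.1 % x.1))

include hroots in
/-- With the true roots the generator list does not depend on the position. -/
theorem gens_trueRoots_indep (v v' : ℕ) : F.gens I v = F.gens I v' := by
  unfold WalkFns.gens; simp_rw [hroots]

include hroots hm in
/-- The elements of the generator list with the true roots are the prime codes `primeL (p, r)`, `p = ps[i]`, `r` a cube root
of `ab²` modulo `p`. -/
theorem mem_gens_trueRoots_iff (v : ℕ) (c : ℕ × List ℤ) :
    c ∈ F.gens I v ↔ ∃ i < I.ps.length, ∃ r < I.ps.getD i 0,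
      r ^ 3 % I.ps.getD i 0 = (a * b ^ 2) % I.ps.getD i 0 ∧ c = F.primeL ((I.a, I.b), (I.ord, (I.ps.getD i 0, r))) := by
  unfold WalkFns.gens
  simp_rw [hroots, List.mem_flatMap, List.mem_range, List.mem_map, List.mem_filter, List.mem_range, decide_eq_true_eq, hm]
  constructor
  · rintro ⟨i, hi, r, ⟨hr, hr3⟩, rfl⟩; exact ⟨i, hi, r, hr, hr3, rfl⟩
  · rintro ⟨i, hi, r, hr, hr3, rfl⟩; exact ⟨i, hi, r, ⟨hr, hr3⟩, rfl⟩

include hroots hps in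
/-- The generator list with the true roots has at most `T = 3|ps|` elements. -/
theorem length_gens_trueRoots_le (v : ℕ) : (F.gens I v).length ≤ 3 * I.ps.length := by
  unfold WalkFns.gens
  simp_rw [hroots]
  rw [List.length_flatMap]
  have h : ∀ i ∈ List.range I.ps.length, ((List.range (I.ps.getD i 0)).filter
      (fun r => r ^ 3 % I.ps.getD i 0 = I.m % I.ps.getD i 0) |>.map
        (fun rt => F.primeL ((I.a, I.b), (I.ord, (I.ps.getD i 0, rt))))).length ≤ 3 := by
    intro i hi
    rw [List.mem_range] at hi
    rw [List.length_map]
    have hp : (I.ps.getD i 0).Prime := by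
      rw [List.getD_eq_getElem _ _ hi]; exact (hps _ (List.getElem_mem hi)).1
    exact cubeRoots_length_le_three hp I.m
  calc (List.map (fun i => ((List.range (I.ps.getD i 0)).filter
        (fun r => r ^ 3 % I.ps.getD i 0 = I.m % I.ps.getD i 0) |>.map
          (fun rt => F.primeL ((I.a, I.b), (I.ord, (I.ps.getD i 0, rt))))).length) (List.range I.ps.length)).sum
      ≤ (List.map (fun _ => 3) (List.range I.ps.length)).sum := List.sum_le_sum (fun i hi => h i hi)
    _ = 3 * I.ps.length := by simp [mul_comm]

include ha hb hm hps hord hordm hprime hroots in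
/-- **The slot package.** There are integral ideals `𝔤_t` such that for every position `v` and every `t < 3|ps|` the slot
`gT v t` is the canonical code of `𝔤_t ≠ ⊥`; each `𝔤_t` is `𝓞_K` or a prime whose norm is in `ps`; every prime of norm
`p ∈ ps` is some `𝔤_t`; and the slots do not depend on `v`. -/
theorem slots_package :
    ∃ 𝔤 : ℕ → Ideal (𝓞 K),
      (∀ v t, t < 3 * I.ps.length → 𝔤 t ≠ ⊥ ∧ Canon (F.gT I v t) ∧
        ∀ φ : K, Mem θ I.b (F.gT I v t) φ ↔ φ ∈ ((𝔤 t : Ideal (𝓞 K)) : FractionalIdeal (𝓞 K)⁰ K)) ∧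
      (∀ t, t < 3 * I.ps.length → 𝔤 t = ⊤ ∨ ((𝔤 t).IsPrime ∧ Ideal.absNorm (𝔤 t) ∈ I.ps)) ∧
      (∀ p ∈ I.ps, ∀ Q : Ideal (𝓞 K), Q.IsPrime → Ideal.absNorm Q = p → ∃ t, t < 3 * I.ps.length ∧ 𝔤 t = Q) ∧
      (∀ v v' t, F.gT I v t = F.gT I v' t) := by
  classical
  have hgT : ∀ v v' t, F.gT I v t = F.gT I v' t := fun v v' t => by
    unfold WalkFns.gT; rw [gens_trueRoots_indep hroots v v']
  have hmemI : ∀ φ : K, Mem θ I.b I.ord φ ↔ φ ∈ ((⊤ : Ideal (𝓞 K)) : FractionalIdeal (𝓞 K)⁰ K) := fun φ => by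
    rw [hb, hordm φ, FractionalIdeal.coeIdeal_top, mem_one_iff_isIntegral]
  -- every slot codes some nonzero integral ideal: a prime of norm in `ps`, or `⊤`
  have hslotP : ∀ t, ∃ P : Ideal (𝓞 K), P ≠ ⊥ ∧ Canon (F.gT I 0 t) ∧
      (∀ φ : K, Mem θ I.b (F.gT I 0 t) φ ↔ φ ∈ (P : FractionalIdeal (𝓞 K)⁰ K)) ∧
      (P = ⊤ ∨ (P.IsPrime ∧ Ideal.absNorm P ∈ I.ps)) := by
    intro t
    by_cases ht : t < (F.gens I 0).length
    · have hmem : F.gT I 0 t ∈ F.gens I 0 := by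
        unfold WalkFns.gT; rw [List.getD_eq_getElem _ _ ht]; exact List.getElem_mem ht
      obtain ⟨i, hi, r, hr, hr3, hc⟩ := (mem_gens_trueRoots_iff hm hroots 0 _).1 hmem
      have hpi : (I.ps.getD i 0) ∈ I.ps := by rw [List.getD_eq_getElem _ _ hi]; exact List.getElem_mem hi
      obtain ⟨hp, hpd⟩ := hps _ hpi
      rw [hm, show 3 * (a * b ^ 2) = (3 * (a * b)) * b by ring] at hpd
      have hpd' : ¬ I.ps.getD i 0 ∣ 3 * (a * b) := fun h => hpd (dvd_mul_of_dvd_left h _)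
      obtain ⟨hroot, -, -⟩ := hprime _ hp hpd'
      obtain ⟨hcan, P, hP0, hPp, hPn, hPm⟩ := hroot r hr hr3
      refine ⟨P, nonZeroDivisors.ne_zero hP0, by rw [hc, ha, hb]; exact hcan, fun φ => ?_, Or.inr ⟨hPp, by rw [hPn]; exact hpi⟩⟩
      rw [hc, ha, hb, hPm φ, FractionalIdeal.mem_coeIdeal]
    · push Not at ht
      have hgt : F.gT I 0 t = I.ord := by unfold WalkFns.gT; rw [List.getD_eq_default _ _ ht]
      exact ⟨⊤, by simp, hgt ▸ hord, fun φ => by rw [hgt]; exact hmemI φ, Or.inl rfl⟩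
  choose 𝔤 h𝔤0 h𝔤c h𝔤m h𝔤kind using hslotP
  refine ⟨𝔤, fun v t _ => ⟨h𝔤0 t, by rw [hgT v 0]; exact h𝔤c t, fun φ => by rw [hgT v 0]; exact h𝔤m t φ⟩,
    fun t _ => h𝔤kind t, fun p hp Q hQ hQn => ?_, hgT⟩
  -- every prime of norm `p ∈ ps` occurs
  obtain ⟨i, hi, hpi⟩ := List.mem_iff_getElem.1 hp
  have hgetD : I.ps.getD i 0 = p := by rw [List.getD_eq_getElem _ _ hi, hpi]
  obtain ⟨hpr, hpd⟩ := hps p hp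
  rw [hm, show 3 * (a * b ^ 2) = (3 * (a * b)) * b by ring] at hpd
  have hpd' : ¬ p ∣ 3 * (a * b) := fun h => hpd (dvd_mul_of_dvd_left h _)
  obtain ⟨-, -, hall⟩ := hprime p hpr hpd'
  obtain ⟨r, hr, hr3, hrQ⟩ := hall Q hQ hQn
  have hmem : F.primeL ((I.a, I.b), (I.ord, (I.ps.getD i 0, r))) ∈ F.gens I 0 :=
    (mem_gens_trueRoots_iff hm hroots 0 _).2 ⟨i, hi, r, by rw [hgetD]; exact hr, by rw [hgetD]; exact hr3, rfl⟩
  obtain ⟨t, ht, htc⟩ := List.mem_iff_getElem.1 hmem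
  have hgt : F.gT I 0 t = F.primeL ((a, b), (I.ord, (p, r))) := by
    unfold WalkFns.gT; rw [List.getD_eq_getElem _ _ ht, htc, ha, hb, hgetD]
  refine ⟨t, lt_of_lt_of_le ht (length_gens_trueRoots_le hps hroots 0), ?_⟩
  rw [← FractionalIdeal.coeIdeal_inj (K := K)]
  apply FractionalIdeal.ext
  intro φ
  rw [← h𝔤m t φ, hgt, hb, hrQ φ, FractionalIdeal.mem_coeIdeal]

end Slots

/-- **P5b helper `classTableSem_slots_package`** (registered): the generator slots of the coin-free class table. -/
theorem classTableSem_slots_package : ∀ (a b : ℕ) (K : Type) [Field K] [NumberField K] (θ : K) (F : CubicClassTable.WalkFns) (I : CubicClassTable.Inst), I.a = a → I.b = b → I.m = a * b ^ 2 → (∀ p ∈ I.ps, p.Prime ∧ ¬ p ∣ 3 * I.m) → PureCubicCodes.Canon I.ord → (∀ φ : K, PureCubicCodes.Mem θ b I.ord φ ↔ IsIntegral ℤ φ) → CubicClassTable.PrimeSem F a b K θ I.ord → (∀ x, F.roots x = (List.range x.1).filter (fun r => r ^ 3 % x.1 = x.2.1 % x.1)) → ∃ 𝔤 : ℕ → Ideal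 (𝓞 K), (∀ v t, t < 3 * I.ps.length → 𝔤 t ≠ ⊥ ∧ PureCubicCodes.Canon (F.gT I v t) ∧ ∀ φ : K, PureCubicCodes.Mem θ I.b (F.gT I v t) φ ↔ φ ∈ ((𝔤 t : Ideal (𝓞 K)) : FractionalIdeal (𝓞 K)⁰ K)) ∧ (∀ t, t < 3 * I.ps.length → 𝔤 t = ⊤ ∨ ((𝔤 t).IsPrime ∧ Ideal.absNorm (𝔤 t) ∈ I.ps)) ∧ (∀ p ∈ I.ps, ∀ Q : Ideal (𝓞 K), Q.IsPrime → Ideal.absNorm Q = p → ∃ t, t < 3 * I.ps.length ∧ 𝔤 t = Q) ∧ (∀ v v' t, F.gT I v t = F.gT I v' t) :=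
  fun _ _ _ _ _ _ _ _ ha hb hm hps hord hordm hprime hroots => slots_package ha hb hm hps hord hordm hprime hroots


end Summit.QuantumAdvantage.QuantumAdvantage.Theorems.LinnikCubicClassGroups
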